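import Literature.InformationTheory.QuantumCodes.QuantumExpanderCodes
import HarnessLib

/-!
# `LTZ15_theorem2` AS TYPED is refutable: the degenerate graph `H = 0` (degrees `Δ_A = Δ_B = 0`)

`QuantumExpanderCodes.LTZ15_theorem2` (Leverrier–Tillich–Zémor 2015, Thm 2, typed 2026-08-27 as a
statement-only named fact) quantifies over ALL `(Δ_A, Δ_B)`-biregular `(γ_A, δ_A, γ_B, δ_B)`-expanding
biadjacency matrices `H : Matrix B A (ZMod 2)` WITHOUT the side condition `0 < Δ_A`, `0 < Δ_B` that its
sibling facts `FGL18_proposition11` / `FGL18_theorem1` carry. For the edgeless graph `H = 0` every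
hypothesis holds vacuously (`IsBiregular 0 0 0`; the expansion inequalities read `(1-δ)·0·|S| ≤ |Γ(S)|`),
the quantum expander code `Q_G` has `H_X = H_Z = 0`, every error has syndrome `0` and the only harmless
error is `0`, so NO decoder corrects both `e = 0` and a single-qubit error — while both have weight
`< w₀ = (1/(3(1+Δ_B))) min(γ_A n_A, γ_B n_B) = 4/3` for `A = B = Fin 4`, `γ_A = γ_B = 1`. Hence
`¬ LTZ15_theorem2` (`not_LTZ15_theorem2`, PROVED, axioms standard).

CLASS: misstated (degenerate case), not substantive. The printed theorem is about biregular expander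
GRAPHS (with edges); the repair is the minimal one already used by `FGL18_proposition11`:
add `0 < dA → 0 < dB →` after `IsLeftRightExpanding …` — proposed corrected signature (for the single
writer of `QuantumExpanderCodes.lean`, to be appended under a new name, e.g. `LTZ15_theorem2_pos`):

  `∀ (A B : Type) [Fintype A] [Fintype B] [DecidableEq A] [DecidableEq B] (H : Matrix B A (ZMod 2))
    (dA dB : ℕ) (γA δA γB δB : ℝ), IsBiregular H dA dB → IsLeftRightExpanding H dA dB γA δA γB δB →
    0 < dA → 0 < dB → 0 < γA → 0 < δA → δA < 1/6 → 0 < γB → 0 < δB → δB < 1/6 → ∀ D, IsSSFDecoder 0 … D →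
    ∀ e, (hammingNorm e : ℝ) < 1/(3(1+dB)) · min (γA n_A) (γB n_B) → D.Corrects …`

The witness below misses the repaired statement (it has `dA = dB = 0`). Whether the repaired per-instance
statement also needs the paper's "letting `n_A, n_B` grow" clause is the separate question already
flagged in the fact's docstring.

References: A. Leverrier, J.-P. Tillich, G. Zémor, *Quantum expander codes*, FOCS 2015, arXiv:1504.00822,
Thm 2 (p0006) — the source's standing assumption "`G` … a `(Δ_A, Δ_B)`-biregular graph" (§2, p0005) is
about graphs with `Δ_A, Δ_B ≥ 1`.
-/

namespace Literature.InformationTheory.QuantumCodes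

open Finset Matrix

/-- For the edgeless bipartite graph (`H = 0`) the `σ_X`-check matrix of `Q_G` vanishes.
[cite: LeverrierTillichZemor2015, §2 (H_X = (𝟙 ⊗ H, Hᵀ ⊗ 𝟙); arXiv v1 p0005 L70-72)] -/
theorem expanderHX_zero {A B : Type*} [Fintype A] [Fintype B] [DecidableEq A] [DecidableEq B] :
    expanderHX (0 : Matrix B A (ZMod 2)) = 0 := by
  ext ⟨a, b⟩ (⟨α, α'⟩ | ⟨β, β'⟩)
  · simp [expanderHX, HypergraphProduct.zMatrix_apply_inl]
  · simp [expanderHX, HypergraphProduct.zMatrix_apply_inr]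

/-- For the edgeless bipartite graph (`H = 0`) the generator matrix of `Q_G` vanishes.
[cite: LeverrierTillichZemor2015, §2 (H_Z = (H ⊗ 𝟙, 𝟙 ⊗ Hᵀ); arXiv v1 p0005 L70-72)] -/
theorem expanderHZ_zero {A B : Type*} [Fintype A] [Fintype B] [DecidableEq A] [DecidableEq B] :
    expanderHZ (0 : Matrix B A (ZMod 2)) = 0 := by
  ext ⟨b, a⟩ (⟨α, α'⟩ | ⟨β, β'⟩)
  · simp [expanderHZ, HypergraphProduct.xMatrix_apply_inl]
  · simp [expanderHZ, HypergraphProduct.xMatrix_apply_inr]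

/-- The edgeless graph is `(0, 0)`-biregular. [cite: LeverrierTillichZemor2015, §2 (biregular; arXiv v1 p0005 L5-8)] -/
theorem isBiregular_zero {A B : Type*} [Fintype A] [Fintype B] [DecidableEq A] [DecidableEq B] :
    IsBiregular (0 : Matrix B A (ZMod 2)) 0 0 := by
  constructor <;> intro _ <;> simp

/-- The edgeless graph is `(γ_A, δ_A, γ_B, δ_B)`-left-right-expanding for degree `0` and ANY parameters
(the expansion inequalities are `0 ≤ |Γ(S)|`). [cite: LeverrierTillichZemor2015, §2 (expansion; arXiv v1 p0005 L9-18)] -/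
theorem isLeftRightExpanding_zero {A B : Type*} [Fintype A] [Fintype B] [DecidableEq A] [DecidableEq B]
    (γA δA γB δB : ℝ) :
    IsLeftRightExpanding (0 : Matrix B A (ZMod 2)) 0 0 γA δA γB δB := by
  constructor
  · intro S _
    simp
  · intro T _
    simp

/-- **`LTZ15_theorem2` as typed is false** (degenerate witness `A = B = Fin 4`, `H = 0`, `Δ_A = Δ_B = 0`,
`γ_A = γ_B = 1`, `δ_A = δ_B = 1/12`): all hypotheses hold, `w₀ = 4/3`, and a small-set-flip decoder `D`
(which exists, `exists_isSSFDecoder`) would have to correct both `e = 0` and a weight-one error, i.e.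
`D 0 = 0` and `D 0 + e₁ = 0` in `rowSpace 0 = ⊥`. Repair: add `0 < dA → 0 < dB` (module docstring).
[cite: LeverrierTillichZemor2015, Thm 2 (arXiv v1 p0006) — typed without the implicit `Δ_A, Δ_B ≥ 1`] -/
theorem not_LTZ15_theorem2 : ¬ LTZ15_theorem2 := by
  intro h
  obtain ⟨D, hD⟩ := exists_isSSFDecoder (0 : ℝ) (expanderHX (0 : Matrix (Fin 4) (Fin 4) (ZMod 2)))
    (expanderHZ (0 : Matrix (Fin 4) (Fin 4) (ZMod 2)))
  have h' := h (Fin 4) (Fin 4) (0 : Matrix (Fin 4) (Fin 4) (ZMod 2)) 0 0 1 (1 / 12) 1 (1 / 12)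
    isBiregular_zero (isLeftRightExpanding_zero 1 (1 / 12) 1 (1 / 12)) one_pos (by norm_num)
    (by norm_num) one_pos (by norm_num) (by norm_num) D hD
  -- the weight bound `w₀ = (1/(3·(1+0))) · min (1·4) (1·4) = 4/3`
  have hw0 : (1 : ℝ) / (3 * (1 + ((0 : ℕ) : ℝ))) * min (1 * (Fintype.card (Fin 4) : ℝ))
      (1 * (Fintype.card (Fin 4) : ℝ)) = 4 / 3 := by
    simp only [Fintype.card_fin]; norm_num
  -- the two errors
  set e₁ : (Fin 4 × Fin 4) ⊕ (Fin 4 × Fin 4) → ZMod 2 := Pi.single (Sum.inl (0, 0)) 1 with he₁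
  have hwt0 : (hammingNorm (0 : (Fin 4 × Fin 4) ⊕ (Fin 4 × Fin 4) → ZMod 2) : ℝ) < 4 / 3 := by
    simp
  have hwt1 : (hammingNorm e₁ : ℝ) < 4 / 3 := by
    have h1 : hammingNorm e₁ = 1 := by
      rw [he₁]
      unfold hammingNorm
      rw [Finset.card_eq_one]
      refine ⟨Sum.inl (0, 0), Finset.ext fun j => ?_⟩
      by_cases hj : j = Sum.inl (0, 0)
      · subst hj; simp
      · simp [hj]
    rw [h1]
    norm_num
  have h0 := h' 0 (by rw [hw0]; exact hwt0)
  have h1 := h' e₁ (by rw [hw0]; exact hwt1)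
  -- both syndromes vanish and the harmless errors are `rowSpace 0 = ⊥`
  simp only [Decoder.Corrects, expanderHX_zero, expanderHZ_zero, Matrix.zero_mulVec, add_zero,
    SetLike.mem_coe, mem_rowSpace_iff, Matrix.vecMul_zero, exists_const] at h0 h1
  -- `h0 : 0 = D 0`, `h1 : 0 = D 0 + e₁`
  have he : e₁ = 0 := by
    have := h1
    rw [← h0, zero_add] at this
    exact this.symm
  have : e₁ (Sum.inl (0, 0)) = 1 := by rw [he₁, Pi.single_eq_same]
  rw [he] at this
  exact zero_ne_one this


/-! ### Appended 2026-08-27 (qec-type-04 g3): `FGL18_proposition11` AS TYPED is refutable — the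
"star forest" with `(d_A, d_B) = (2, 1)` (the typed fact omits the source's convention `d_A ≤ d_B`)

Fawzi–Grospellier–Leverrier 2018, Prop. 11 (`FGL18_proposition11` in `QuantumExpanderCodes.lean`)
gives the adversarial radius `t ≥ (rβ₀/(1+β₀)) min(γ_A n_A, γ_B n_B)`, `r = d_A/d_B`. Its printed proof
(App. B / §7.1, arXiv v2 p0018) rests on the "reduced cardinality" inequality
`d_A ‖E‖ ≤ |E| ≤ d_B ‖E‖`, `‖E‖ = |E ∩ A²|/d_B + |E ∩ B²|/d_A`, which holds only when `d_A ≤ d_B`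
(equivalently `n_A ≥ n_B`; the paper's numerical example has `d_A = 38 < d_B = 39`). The typed fact
quantifies over ALL degree pairs. For `d_A > d_B` it is FALSE: take the star forest `A = Fin 2`
(centres), `B = Fin 4` (leaves), leaf `b` attached to centre `b / 2` — a `(2, 1)`-biregular graph which
is `(1, 1/100)`-left-expanding (distinct centres have disjoint neighbourhoods) and
`(19/40, 1/100)`-right-expanding (the bound `|T| ≤ (19/40)·4 < 2` only constrains `|T| ≤ 1`); here
`r = 2`, `β₀ = 23/25 > 0`, and the radius is `(2·(23/25)/(48/25))·min(2, 19/10) = 437/240 > 1`. But the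
two weight-one errors on the leaf-qubits `(0,0), (1,0) ∈ B × B` have the SAME syndrome (their sum is
annihilated by `H_X`) while their sum is NOT in `rowsp H_Z` (the vector `𝟙_{(0,0)} + 𝟙_{(0,1)}` is
orthogonal to every generator but not to it), so no decoder — small-set-flip or other — corrects both.
Hence `not_FGL18_proposition11` (PROVED, axioms standard). CLASS: misstated (missing standing
convention). Minimal repair we can justify from the printed proof: add the hypothesis `dA ≤ dB`; the
witness has `dA = 2 > dB = 1` and misses it. (Whether the printed proof needs anything further is for
the prover of the repaired fact; this file asserts nothing about it.)

References: O. Fawzi, A. Grospellier, A. Leverrier, *Efficient decoding of random errors for quantum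
expander codes*, STOC 2018, arXiv:1711.08351, Def. 10 / Prop. 11 (§3.2, p0011) and §7.1 eq. "norm prop"
(p0018: `d_A ‖E‖ ≤ |E| ≤ d_B ‖E‖`).
-/

section StarForest

/-- The `(2,1)`-biregular star forest on `A = Fin 2`, `B = Fin 4` (leaf `b` ↦ centre `b / 2`) is
`(2, 1)`-biregular. [cite: FawziGrospellierLeverrier2018, Def 2 (biregular; arXiv v2 p0006)] -/
theorem starForest_isBiregular (H : Matrix (Fin 4) (Fin 2) (ZMod 2))
    (hH : H = Matrix.of fun (b : Fin 4) (a : Fin 2) => if (a : ℕ) = (b : ℕ) / 2 then (1 : ZMod 2) else 0) : IsBiregular H 2 1 := by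
  subst hH
  unfold IsBiregular
  constructor <;> decide

/-- Left neighbourhoods in the star forest: `|Γ(S)| = 2|S|` (disjoint stars).
[cite: FawziGrospellierLeverrier2018, Def 2 (left expansion; arXiv v2 p0006)] -/
theorem starForest_card_leftNbhd (H : Matrix (Fin 4) (Fin 2) (ZMod 2))
    (hH : H = Matrix.of fun (b : Fin 4) (a : Fin 2) => if (a : ℕ) = (b : ℕ) / 2 then (1 : ZMod 2) else 0) (S : Finset (Fin 2)) :
    (leftNbhd H S).card = 2 * S.card := by
  subst hH
  revert S
  decide

/-- Right neighbourhoods of at most one leaf in the star forest: `|Γ(T)| = |T|`.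
[cite: FawziGrospellierLeverrier2018, Def 2 (right expansion; arXiv v2 p0006)] -/
theorem starForest_card_rightNbhd (H : Matrix (Fin 4) (Fin 2) (ZMod 2))
    (hH : H = Matrix.of fun (b : Fin 4) (a : Fin 2) => if (a : ℕ) = (b : ℕ) / 2 then (1 : ZMod 2) else 0) (T : Finset (Fin 4))
    (hT : T.card ≤ 1) : (rightNbhd H T).card = T.card := by
  subst hH
  revert T
  decide

/-- The star forest is `(1, 1/100, 19/40, 1/100)`-left-right-expanding for degrees `(2, 1)` (left:
`|Γ(S)| = 2|S|`; right: `|T| ≤ 19/10` forces `|T| ≤ 1`, then `|Γ(T)| = |T|`).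
[cite: FawziGrospellierLeverrier2018, Def 2 (arXiv v2 p0006)] -/
theorem starForest_isLeftRightExpanding (H : Matrix (Fin 4) (Fin 2) (ZMod 2))
    (hH : H = Matrix.of fun (b : Fin 4) (a : Fin 2) => if (a : ℕ) = (b : ℕ) / 2 then (1 : ZMod 2) else 0) :
    IsLeftRightExpanding H 2 1 1 (1 / 100) (19 / 40) (1 / 100) := by
  constructor
  · intro S _
    rw [starForest_card_leftNbhd H hH S]
    have hS : (0 : ℝ) ≤ S.card := Nat.cast_nonneg _
    push_cast
    nlinarith
  · intro T hT
    have hcard : T.card ≤ 1 := by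
      have h4 : (Fintype.card (Fin 4) : ℝ) = 4 := by simp
      rw [h4] at hT
      have : (T.card : ℝ) < 2 := by linarith
      exact_mod_cast Nat.lt_succ_iff.1 (by exact_mod_cast this : T.card < 2)
    rw [starForest_card_rightNbhd H hH T hcard]
    have hT0 : (0 : ℝ) ≤ T.card := Nat.cast_nonneg _
    push_cast
    nlinarith

/-- In the star forest's quantum expander code the two leaf-qubit errors `𝟙_{(0,0)}`, `𝟙_{(1,0)}`
(in `B × B`) have the same `H_X`-syndrome. [cite: FawziGrospellierLeverrier2018, §2.3 (σ_X(E) = H_X 𝟙_E)] -/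
theorem starForest_syndrome_eq (H : Matrix (Fin 4) (Fin 2) (ZMod 2))
    (hH : H = Matrix.of fun (b : Fin 4) (a : Fin 2) => if (a : ℕ) = (b : ℕ) / 2 then (1 : ZMod 2) else 0) :
    expanderHX H *ᵥ (Pi.single (Sum.inr ((0 : Fin 4), (0 : Fin 4))) 1
        : (Fin 2 × Fin 2) ⊕ (Fin 4 × Fin 4) → ZMod 2)
      = expanderHX H *ᵥ (Pi.single (Sum.inr ((1 : Fin 4), (0 : Fin 4))) 1) := by
  subst hH
  unfold expanderHX HypergraphProduct.zMatrix
  decide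

/-- The vector `v = 𝟙_{(0,0)} + 𝟙_{(0,1)}` (in `B × B`) is orthogonal to every generator of the star
forest's code: `H_Z v = 0`. [cite: FawziGrospellierLeverrier2018, §2.3 (the generators = rows of H_Z)] -/
theorem starForest_generators_orthogonal (H : Matrix (Fin 4) (Fin 2) (ZMod 2))
    (hH : H = Matrix.of fun (b : Fin 4) (a : Fin 2) => if (a : ℕ) = (b : ℕ) / 2 then (1 : ZMod 2) else 0) :
    expanderHZ H *ᵥ ((Pi.single (Sum.inr ((0 : Fin 4), (0 : Fin 4))) 1
        : (Fin 2 × Fin 2) ⊕ (Fin 4 × Fin 4) → ZMod 2)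
        + Pi.single (Sum.inr ((0 : Fin 4), (1 : Fin 4))) 1) = 0 := by
  subst hH
  unfold expanderHZ HypergraphProduct.xMatrix
  decide

/-- **`FGL18_proposition11` as typed is false** (witness: the `(2,1)`-biregular star forest on
`Fin 2`/`Fin 4`, `γ_A = 1`, `γ_B = 19/40`, `δ_A = δ_B = 1/100`, so `r = 2`, `β₀ = 23/25`, radius
`437/240 ≥ 1`; the weight-one errors `𝟙_{(0,0)}` and `𝟙_{(1,0)}` share a syndrome and differ by a
non-trivial logical operator, so no small-set-flip decoder (one exists by `exists_isSSFDecoder`) corrects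
both). Repair: add `dA ≤ dB` (module section docstring).
[cite: FawziGrospellierLeverrier2018, Prop 11 with Def 10 (§3.2, arXiv v2 p0011) — typed without the convention d_A ≤ d_B of §7.1 eq. (norm prop), p0018] -/
theorem not_FGL18_proposition11 : ¬ FGL18_proposition11 := by
  intro h
  set H : Matrix (Fin 4) (Fin 2) (ZMod 2) := Matrix.of fun (b : Fin 4) (a : Fin 2) => if (a : ℕ) = (b : ℕ) / 2 then (1 : ZMod 2) else 0
    with hH
  obtain ⟨D, hD⟩ := exists_isSSFDecoder (betaZero 2 1 (1 / 100 : ℝ) (1 / 100) * (1 : ℕ))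
    (expanderHX H) (expanderHZ H)
  have hβ : betaZero 2 1 (1 / 100 : ℝ) (1 / 100) = 23 / 25 := by
    unfold betaZero
    norm_num
  have h' := h (Fin 2) (Fin 4) H 2 1 1 (1 / 100) (19 / 40) (1 / 100) (starForest_isBiregular H hH)
    (starForest_isLeftRightExpanding H hH) (by norm_num) (by norm_num) one_pos (by norm_num)
    (by norm_num) (by norm_num) (by rw [hβ]; norm_num) D hD
  -- the radius `r β₀/(1+β₀) · min(γ_A n_A, γ_B n_B) = 437/240 ≥ 1`
  have hrad : (1 : ℝ) ≤ ((2 : ℕ) : ℝ) / ((1 : ℕ) : ℝ) * betaZero 2 1 (1 / 100 : ℝ) (1 / 100)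
      / (1 + betaZero 2 1 (1 / 100 : ℝ) (1 / 100))
      * min (1 * (Fintype.card (Fin 2) : ℝ)) (19 / 40 * (Fintype.card (Fin 4) : ℝ)) := by
    rw [hβ]
    simp only [Fintype.card_fin]
    rw [min_eq_right (by norm_num)]
    norm_num
  -- the two weight-one errors
  set e₁ : (Fin 2 × Fin 2) ⊕ (Fin 4 × Fin 4) → ZMod 2 := Pi.single (Sum.inr (0, 0)) 1 with he₁
  set e₂ : (Fin 2 × Fin 2) ⊕ (Fin 4 × Fin 4) → ZMod 2 := Pi.single (Sum.inr (1, 0)) 1 with he₂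
  have hw : ∀ q : (Fin 2 × Fin 2) ⊕ (Fin 4 × Fin 4),
      hammingNorm (Pi.single q (1 : ZMod 2) : (Fin 2 × Fin 2) ⊕ (Fin 4 × Fin 4) → ZMod 2) = 1 := by
    intro q
    unfold hammingNorm
    rw [Finset.card_eq_one]
    refine ⟨q, Finset.ext fun j => ?_⟩
    by_cases hj : j = q
    · subst hj; simp
    · simp [hj]
  have h1 := h' e₁ (by rw [he₁, hw]; exact_mod_cast hrad)
  have h2 := h' e₂ (by rw [he₂, hw]; exact_mod_cast hrad)
  -- same syndrome
  have hsyn : expanderHX H *ᵥ e₁ = expanderHX H *ᵥ e₂ := by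
    rw [he₁, he₂]; exact starForest_syndrome_eq H hH
  simp only [Decoder.Corrects, SetLike.mem_coe] at h1 h2
  rw [hsyn] at h1
  -- hence `e₁ + e₂ ∈ rowsp H_Z`
  have hsum : e₁ + e₂ ∈ rowSpace (expanderHZ H) := by
    have hadd := Submodule.add_mem _ h1 h2
    have hcancel : D (expanderHX H *ᵥ e₂) + e₁ + (D (expanderHX H *ᵥ e₂) + e₂) = e₁ + e₂ := by
      ext q
      simp only [Pi.add_apply]
      have h2z : ∀ z x y : ZMod 2, z + x + (z + y) = x + y := by decide
      exact h2z _ _ _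
    rw [hcancel] at hadd
    exact hadd
  -- but `e₁ + e₂` is not orthogonal to `v = 𝟙_{(0,0)} + 𝟙_{(0,1)}`, which every generator is
  set v : (Fin 2 × Fin 2) ⊕ (Fin 4 × Fin 4) → ZMod 2 :=
    Pi.single (Sum.inr (0, 0)) 1 + Pi.single (Sum.inr (0, 1)) 1 with hv
  have hv0 : expanderHZ H *ᵥ v = 0 := by rw [hv]; exact starForest_generators_orthogonal H hH
  rw [mem_rowSpace_iff] at hsum
  obtain ⟨y, hy⟩ := hsum
  have hdot : (e₁ + e₂) ⬝ᵥ v = 0 := by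
    rw [← hy, ← Matrix.dotProduct_mulVec, hv0, dotProduct_zero]
  have hdot' : (e₁ + e₂) ⬝ᵥ v = 1 := by
    rw [he₁, he₂, hv]
    decide
  rw [hdot'] at hdot
  exact one_ne_zero hdot

end StarForest

end Literature.InformationTheory.QuantumCodes
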